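import Literature.MathematicalPhysics.QuantumFieldTheory.Balaban1983to89.Beta.WilsonVertex

/-!
# `Balaban1983to89.Beta.PlaquetteVertex` — THE WILSON PLAQUETTE VERTEX SUMMED OVER THE LATTICE, TYPED AS LATTICE FORMS: the
`(W², B¹)` jet of `Σ_x Σ_{(μ,ν)} τ U(∂p_{μν}(x))` (`U_b = e^{W_b}e^{B_b}`) splits EXACTLY into a LOCAL SPIN FORM + a DIFFERENCE SPIN
FORM + a TRANSPORT FORM (`jet21_split`); in colour coordinates the local spin form IS the quadratic form of `SpinTable.spinOp` of the
plaquette field (`spinLocal_field`), at a one-bond background it IS the quadratic form of `SpinTable.spinVertex` (`spinLocal_field_bondLetter`),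
and in Bałaban's Hessian convention `A(e^{W}U₀) = A(U₀) + ⟨W,J⟩ + ½⟨W, ΔW⟩ + …` the explicit plaquette term therefore carries the spin
vertex with coefficient `s_expl = −1`, `s_expl² = 1` (`actionJet21_field_bondLetter`, exact, the difference and transport forms as
explicit remainder) — ONE of the two units `s² = 4` that the realised
leg table requires (`SpinTable.coeff_sq_iff`; `coeff_sq_sExpl`, `coeff_sq_two_units`), DERIVED from the group product, measured against
the kinetic term `½⟨v, curl†_G curl v⟩` whose colour metric `G` is the Gram matrix of the letters (`jet20_field`), `= 1` for Bałaban's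
tr-orthonormal generators, for which the colour matrix of the background letter `iτ_c` is `ColourTrace.adMat τ (τ_c)` ON THE NOSE
(`adM_gen`, `gram_gen`) — the very matrix `SpinTable.three_sectors_gen` feeds to the vertices.  β sub-cell, row BETA-an3 gen 11, node
BETA-an3-g11-PLAQ-VERTEX = successor (S-next) of `Beta.WilsonVertex` (gen 10) on the TABLE SIDE (D1-rep) of the wall's one-loop binder.

HONEST FRAMING (mandatory, page 1).  «discharging `BetaPertH` makes Bałaban's UV stability UNCONDITIONAL — a real
constructive-QFT result; it is NOT the continuum limit and NOT the Clay problem.»  Gloss 1 (the LEAD's, BETA-SPEC §0):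
«unconditional» means the coupling-window HYPOTHESIS of [Balaban1989LargeFieldII] (B16) p. 355's one displayed END STATEMENT is
discharged INSIDE THE LATTICE RENORMALIZATION PROGRAMME; every other input remains a verbatim QUOTATION of Bałaban's printed
theorems — the result is «B16's theorem with one hypothesis fewer», not a first-principles formalisation of B5–B16.  Gloss 2: the
object is the `EventualForm`-unconditional END statement, NOT «Theorem 2 as printed».  Gloss 3″ (binding): what is made
unconditional is an END STATEMENT under the explicit γ-smallness restrictions of the kernel binders — never «Theorem 2 as printed»,
never the continuum limit / mass gap / Clay.  THIS FILE discharges nothing of `BetaPertH`; it is one algebraic input of the table side: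
a kernel certificate of WHICH TERM of the actual plaquette action produces the spin sector of the model table, with WHICH coefficient.

ABSOLUTE RULE (cell charter, verbatim in substance).  No internally-minted statement enters as a cited fact: every hypothesis of every
theorem below is kernel-proved in this package; NOTHING is cited.  The manuscript under audit ([Balaban1985BackgroundPropagators] = B9)
appears ONLY as CONTEXT — to say which printed display each derived identity is the algebraic skeleton of; no disputed step of B9 is
used, and programme-internal (2001 / route / tribunal) claims are never cited.

WHAT IS IN PRINT (context, cited by number; nothing of it is used below).  T. Bałaban, *Propagators for lattice gauge theories in a
background field*, Commun. Math. Phys. 99 (1985) 389–434 [Balaban1985BackgroundPropagators]: p. 390 (3.1)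
`A^η(U′U₀) = Σ_{p ⊂ T_η} η^{d−4}[1 − Re tr(U′U₀)(∂p)]`, `U′ = exp iηA` — ONE term per plaquette `p ⊂ T_η`; p. 391 (3.4) the plaquette
derivative and «(D^η_{U₀}A)(p_{μν}(x)) = (D^η_{U₀,μ}A_ν)(x) − (D^η_{U₀,ν}A_μ)(x)», «The above definitions are for oriented bonds and
plaquettes … if we change an orientation of a plaquette … (D^η_{U₀}A)(−p) = −(D^η_{U₀}A)(p)», (3.5) `U(x,x′) = U(x′,x)⁻¹`,
`A(x,x′) = −A(x′,x)`; (3.6) the second-order expansion of the transported plaquette variable with the ordered-pair term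
`Σ_{b₁≺b₂} i[A′(b₁), A′(b₂)]`; (3.7) `… = A^η(U₀) + ⟨…⟩ + ½⟨A, Δ^η(U₀)A⟩ + …` and «This expansion is valid also for configurations A and
U₀ with values respectively in the complexified algebra g^c and the group G^c, we have to interpret only Re U₀(∂p) and Im U₀(∂p) as
Re U₀(∂p) = ½(U₀(∂p) + U₀(−∂p)), Im U₀(∂p) = (1/2i)(U₀(∂p) − U₀(−∂p)).  Here −∂p is the contour ∂(−p), and U₀(−∂p) = (U₀(∂p))⁻¹.»;
p. 392 «⟨X, Y⟩ = tr XY», «Let us recall that the trace is normalized, i.e., tr 1 = 1», (3.10) `⟨A, ΔA⟩ = ⟨A, (D*D + Δ′(U))A⟩ = … +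
tr Σ_{b₁<b₂⊂∂(p)} i[A′(b₁), A′(b₂)] η⁻² Im U(∂p)` («Δ′ will be a bounded, small operator, … a small perturbation of D*D»), (3.12)
`A^η(exp iηA·U) = A^η(U) + ⟨A, J⟩ + ½⟨A, ΔA⟩ + …` — THE HESSIAN CONVENTION `½⟨A, ΔA⟩` in which a «spin coupling» is a coefficient.

THE SETTING (definitions asserting nothing).  A lattice `Λ` (any finite additive group), directions `D` (any finite type), a frame
`e : D → Λ`; bond fields `X : Λ → D → M`; `lcurl e X x μ ν = (X_ν(x+e_μ) − X_ν(x)) − (X_μ(x+e_ν) − X_μ(x))` (the `U₀ = 1` plaquette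
derivative; `= SpinTable.curl` for colour-matrix values, `lcurl_eq_curl`); `bondLetter z γ Y` (the bond `(z,γ)` carries `Y`, all others
`0`; `= SpinTable.bondField`, `bondLetter_eq_bondField`).  `plaqWord e W B x μ ν` = `WilsonVertex.plaq` at the letters of `p_{μν}(x)`
(`W_μ(x), W_ν(x+e_μ), W_μ(x+e_ν), W_ν(x)` and the `B`'s likewise); `jet21 𝕜 τ e W B = Σ_x Σ_μ Σ_ν τ(P21 𝕜 (plaqWord …))` (ALL ordered
pairs; the diagonal words are trivial), `jet20` likewise with `quad 𝕜 (wpart …)`.  The three RING-LEVEL forms (any ring `𝔸`, any linear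
`τ`): `spinLocal τ e W B = Σ τ(F_{μν}(x)·[W_μ(x), W_ν(x)])` (`F = lcurl e B`), `spinDiff` (the same with `pairDiff`: one lattice
difference on a fluctuation leg), `transport τ e W B = Σ τ((lcurl W)_{μν}(x)·twistW)` (`twistW` = `WilsonVertex.twist_plaq`'s three
background commutators).  COORDINATES (§3): `field t v x k = Σ_a v(x,(a,k))•t_a` for a letter family `t : C → 𝔸` and `v : Λ × (C × D) → ℝ`
(`SpinTable`'s carrier); `adM τ t F a b = τ(F·[t_a,t_b])` (the colour matrix of the letter `F`), `gram τ t a b = −τ(t_at_b)`;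
`curlForm G e u = Σ_x Σ_μ Σ_ν (lcurl u)ᵀ G (lcurl u)`.  LETTERS (§4): `rntr = Re tr` on `Mat_N(ℂ)` as an `ℝ`-linear functional (tr
normalised), `gen τ c = i·τ_c`.

WHAT THIS FILE PROVES (all [folklore]; §1–§2 for any `NormedRing`/`NormedAlgebra 𝕜` and any tracial linear `τ : 𝔸 →ₗ[𝕜] V`; §3 for
any real algebra and any `ℝ`-linear `τ`; §4 for `Mat_N(ℂ)`; no adjoint, no positivity, no bound anywhere).
* §1 `plaqPairs_eq_local_add_pairDiff : plaqPairs X Y X′ Y′ = 2[X,Y] + pairDiff X Y (X′−X) (Y′−Y)` (LOCAL + DIFFERENCE split of B9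
  (3.10)'s pair sum, from `SpinTable.plaqPairs_expand`); `trace_commSum = 0`, `two_smul_trace_quad : 2τ(quad l) = τ((Σl)²)`.
* §2 `trace_P21_plaqWord_add_swap` (word of `p_{νμ}(x)` = inverse word of `p_{μν}(x)`, `inv_plaqWord`; pair = `τ(F·plaqPairs) +
  2τ((lcurl W)·twistW)`), `trace_P21_plaqWord_self = 0`, `jet21_eq_offDiag`, `jet21_eq` (symmetrising the ordered-pair sum IS
  Bałaban's real part: `jet21 = Σ [½τ(F·plaqPairs) + τ((lcurl W)·twistW)]`, no symmetric cubic), **`jet21_split : jet21 = spinLocal +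
  ½·spinDiff + transport`**, `jet20_eq : jet20 = ½Σ τ((lcurl W)²)`; DEGENERACY NOTE `sum_lcurl`/`spinLocal_const`: summed over the
  lattice a CONSTANT fluctuation sees no spin form at all (`Σ_x F_{μν}(x) = 0`) — coefficients are read off identities valid for ALL `v`.
* §3 `dotProduct_spinOp_mulVec` (the quadratic form of `SpinTable.spinOp`, block-diagonal in sites), `trace_mul_br_sum`,
  **`spinLocal_field : spinLocal τ e (field t v) B = v ⬝ᵥ spinOp (adM ∘ lcurl e B) *ᵥ v`** (every `B`, `t`, `τ`),
  `adM_lcurl_bondLetter` (`adM ∘ lcurl (bondLetter z γ Y) = SpinTable.curl e (SpinTable.bondField z γ (adM Y))`),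
  **`spinLocal_field_bondLetter : spinLocal τ e (field t v) (bondLetter z γ Y) = v ⬝ᵥ SpinTable.spinVertex e z γ (adM Y) *ᵥ v`**
  (via `SpinTable.spinOp_curl_bondField`), `sum_trace_lcurl_sq_field`/`jet20_field : jet20 = −½·curlForm (gram τ t)`, and
  **`actionJet21_field_bondLetter`** (every `v`): `−½·jet21 = ½·vᵀ((−1)•spinVertex e z γ (adM Y))v − ¼·spinDiff − ½·transport`.
* §4 `adM_gen : adM rntr (gen τ) (gen τ c) = ColourTrace.adMat τ (τ c)` (cyclicity of the trace only — no hypothesis on the family),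
  `gram_gen : gram rntr (gen τ) = 1` under `ColourTrace.TrOrthonormal τ`, `N ≠ 0`, and the instance **`actionJet21_field_bondLetter_gen`**
  (`Mat_N(ℂ)`, `Re tr`, letters `iτ_a`, background letter `iτ_c` on one bond, every `v`: `−½·jet21 = ½·vᵀ((−1)•spinVertex e z γ
  (adMat τ (τ_c)))v − ¼·spinDiff − ½·transport`;
  Mathlib's `Matrix.linftyOpNormedAlgebra` enabled locally as the carrier norm — the statement is norm-free).
* §5 `sExpl = −1`, `sExpl_sq`, `coeff_sq_sExpl : 2N²·sExpl² ≠ 8N²`, `coeff_sq_two_units : 2N²·(sExpl + sExpl)² = 8N²`.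

THE READING (dictionary; context only, asserted nowhere below).  With `W_b ↔ iηA(b)`, `e^{B_b} ↔ U₀(b)` in the exponential chart,
`τ ↔ tr` (p. 392; real part taken by symmetrisation, p. 391), and each unoriented plaquette of (3.1) met twice in the ordered-pair sum
(as `∂p` and `−∂p`, `inv_plaqWord`; diagonal words trivial): the `(W², B¹)` jet of `Σ_{p}[1 − Re tr U(∂p)]` is `−½·jet21` and its
`(W², B⁰)` jet is `−½·jet20 = ¼·curlForm G = ½·⟨v, curl†_G curl v⟩` with `⟨v, curl†_G curl v⟩ = Σ_x Σ_{μ<ν}(curl v)ᵀG(curl v)` — the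
`U₀ = 1` kinetic operator `d*d` of (3.10) in the colour metric `G = gram`, `= 1` for tr-orthonormal generators (`gram_gen`).  In that
normalisation and in the Hessian convention `½⟨A, ΔA⟩` of (3.7)/(3.12), the LOCAL part of the `B`-linear Hessian coming from the
explicit plaquette term is `−1 · spinOp(adM ∘ F)` (`spinLocal_field`, `actionJet21_field_bondLetter`): in the MODEL
`K_vec = ∇*∇ ⊗ 1 + s·spinOp(curl B)` of `SpinTable` §4 (background bond matrices `A = adM` of the letters, `= adMat τ (τ_c)` for the
letter `iτ_c`, `adM_gen`) the explicit term contributes `s_expl = −1`, ONE UNIT, the sign being relative to `SpinTable`'s orientation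
conventions (`spinDir`, `inner`, `curl`) and invisible in the table (`three_sectors` is even in `s`).  LABELLED, located, NOT derived
here: the SECOND unit — the curvature term of the Weitzenböck identity completing Bałaban's covariant `D*D` (the `transport` form is
its `B`-linear germ) by the longitudinal part to the covariant bond Laplacian (B9 (3.26) / [Balaban1987RG1] (1.5); `SpinTable` header
(i); owner an2 / (V-con)) — with it `s = 2·s_expl`, `s² = 4` (`coeff_sq_two_units`); without it the explicit term alone gives the
square coefficient `2N²`, one quarter of the realised `8N²` (`coeff_sq_sExpl`).  Also labelled: `spinDiff` and `transport` are NOT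
typed as `BubbleTable` stencils here; their structure is kernel-visible from the definitions.  TWO GRADINGS (v1.1; nothing asserted):
(w) the number of lattice differences on FLUCTUATION legs — `spinLocal` 0, `spinDiff` ≥ 1, `transport` ≥ 1 (`lcurl W` is a pure
difference: both vanish per plaquette at constant `W`; this is the sense of `SpinTable.plaqPairs_expand` and of `Beta.WilsonVertex`'s
remark «transport … of higher table degree», which STANDS — v1.0 of this header called it inexact, wrongly, by mixing (w) with (t));
(t) the total number of differences on ALL legs, background included (naive power counting) — `spinLocal` 1 (the curl on `B`),
`spinDiff` 2, and `transport` splits: regrouping its accumulated backgrounds, `twistW = [B_μ(x), W_ν(x+e_μ)] − [B_ν(x), W_μ(x+e_ν)]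
− [F_{μν}(x), W_μ(x+e_ν) + W_ν(x)]` (`F = lcurl e B`; the last accumulated sum in the definition IS `F`), i.e. a MINIMAL part of
degree 1 (single undifferentiated background letter against one fluctuation difference — the hopping shape of `GhostTable.current`)
plus an `F`-part of degree 2 (the shape of `spinDiff`).  In the base-point expansion neither part of `transport` contains the local
commutator `[W_μ(x), W_ν(x)]`, so `−1` is the full local spin coefficient of the explicit plaquette term in that expansion; the spin
content hidden in `transport`'s minimal part (the Weitzenböck unit above) appears only after completing the square / summing by parts,
and is located, not derived, here.

NOT DONE HERE: the `(2,2)` contact jet `P22` (the `W²B²` plaquette vertex and its contact table); the (V-con) constraint / averaging /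
`R_U` rows, the Weitzenböck unit and the contact kernels `K″` (brick (V) of HOME/BETA/AN2.md §13.3, an2's); (T-def); the stencil typing
of `spinDiff`/`transport` and their (expected log-free) tables; any bound (the remainder bounds of `Beta.TransportVertices` §1–§2 apply
to plaquette words verbatim); anything about `BetaPertH`.

Version v1.1 (gen 11; v1.0 = the same declarations byte for byte; this header's v1.0 clause «CORRECTION of record» replaced by TWO
GRADINGS, the `transport`/`twistW` docstrings regraded, `twistW_regroup` added).  GAPS record C-beta-an3-22.  All tags [folklore]: finite sums and polynomial algebra.
-/

noncomputable section

namespace Literature.MathematicalPhysics.QuantumFieldTheory.Balaban1983to89.Beta.PlaquetteVertex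

open Finset
open scoped BigOperators Matrix
open Literature.MathematicalPhysics.QuantumFieldTheory.Balaban1983to89.Beta.TransportVertices
open Literature.MathematicalPhysics.QuantumFieldTheory.Balaban1983to89.Beta.WilsonVertex
open Literature.MathematicalPhysics.QuantumFieldTheory.Balaban1983to89.Beta.BubbleTable (elemIns elemIns_apply)
open Literature.MathematicalPhysics.QuantumFieldTheory.Balaban1983to89.Beta.SpinTable (br plaqPairs plaqPairs_local
  plaqPairs_expand spinOp spinOp_apply spinVertex spinOp_curl_bondField coeff_sq_iff)

/-! ## §1 Ring-level addenda: the local/difference split of the pair sum; traces of `commSum` and `quad` -/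

section RingLevel

variable {R : Type*} [Ring R]

/-- THE DIFFERENCE PART of the plaquette pair sum: `2[X,δY] − 2[Y,δX] − [X,δX] + [Y,δY] − [δY,δX]` — every monomial
carries a lattice difference `δX` or `δY` of a FLUCTUATION letter.  A definition asserting nothing. [folklore] -/
def pairDiff (X Y dX dY : R) : R := 2 * br X dY - 2 * br Y dX - br X dX + br Y dY - br dY dX

/-- **LOCAL + DIFFERENCE SPLIT** of B9 (3.10)'s ordered-pair sum: `plaqPairs X Y X′ Y′ = 2[X,Y] + pairDiff X Y (X′−X) (Y′−Y)`
(`SpinTable.plaqPairs_expand` read with `δX = X′ − X`, `δY = Y′ − Y`). [folklore] -/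
theorem plaqPairs_eq_local_add_pairDiff (X Y X' Y' : R) :
    plaqPairs X Y X' Y' = 2 * br X Y + pairDiff X Y (X' - X) (Y' - Y) := by
  have h := plaqPairs_expand X Y (X' - X) (Y' - Y)
  rw [add_sub_cancel, add_sub_cancel] at h
  rw [h, pairDiff]
  abel

/-- `pairDiff` vanishes when both differences vanish (constant fluctuation field). [folklore] -/
@[simp] theorem pairDiff_zero_zero (X Y : R) : pairDiff X Y 0 0 = 0 := by
  simp [pairDiff, br]

/-- `br` is additive on the left. [folklore] -/
theorem br_add_left (X X' Y : R) : br (X + X') Y = br X Y + br X' Y := by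
  simp only [br]; noncomm_ring

/-- `br` is additive on the right. [folklore] -/
theorem br_add_right (X Y Y' : R) : br X (Y + Y') = br X Y + br X Y' := by
  simp only [br]; noncomm_ring

end RingLevel

section Traces

variable (𝕜 : Type*) [RCLike 𝕜] {𝔸 : Type*} [NormedRing 𝔸] [NormedAlgebra 𝕜 𝔸]
variable {V : Type*} [AddCommGroup V] [Module 𝕜 V]

/-- a tracial functional kills every ordered commutator sum. [folklore] -/
theorem trace_commSum (τ : 𝔸 →ₗ[𝕜] V) (hτ : ∀ a b : 𝔸, τ (a * b) = τ (b * a)) (l : List 𝔸) : τ (commSum l) = 0 := by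
  induction l with
  | nil => simp
  | cons b l ih => rw [commSum_cons, map_add, ih, map_sub, hτ b l.sum, sub_self, add_zero]

/-- twice the trace of the second-order term of an ordered product is the trace of the SQUARE OF THE LETTER SUM:
`2·τ(quad l) = τ((Σl)²)` (`TransportVertices.two_smul_quad` + traciality). [folklore] -/
theorem two_smul_trace_quad (τ : 𝔸 →ₗ[𝕜] V) (hτ : ∀ a b : 𝔸, τ (a * b) = τ (b * a)) (l : List 𝔸) :
    (2 : 𝕜) • τ (quad 𝕜 l) = τ (l.sum * l.sum) := by
  rw [← map_smul, two_smul_quad, map_add, trace_commSum 𝕜 τ hτ l, add_zero]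

end Traces

/-! ## §2 The lattice curl, the plaquette forms (ring level), the plaquette words and the summed jets -/

section Curl

variable {Λ : Type*} [AddCommGroup Λ] {D : Type*} {M : Type*} [AddCommGroup M]

/-- THE LATTICE CURL of a bond field with values in any additive group (`U = 1` form of B9 p. 391
«(DA)(p_{μν}(x)) = (D_μA_ν)(x) − (D_νA_μ)(x)», forward differences along the frame `e`); for `Matrix C C ℝ`-valued fields it
is `SpinTable.curl` on the nose (`lcurl_eq_curl`). [folklore] -/
def lcurl (e : D → Λ) (X : Λ → D → M) (x : Λ) (μ ν : D) : M := (X (x + e μ) ν - X x ν) - (X (x + e ν) μ - X x μ)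

/-- the curl is antisymmetric in the direction pair. [folklore] -/
theorem lcurl_swap (e : D → Λ) (X : Λ → D → M) (x : Λ) (μ ν : D) : lcurl e X x ν μ = -lcurl e X x μ ν := by
  simp only [lcurl]; abel

/-- the curl vanishes on the direction diagonal. [folklore] -/
@[simp] theorem lcurl_self (e : D → Λ) (X : Λ → D → M) (x : Λ) (μ : D) : lcurl e X x μ μ = 0 := by
  simp only [lcurl, sub_self]

/-- the signed boundary sum of the four letters of `p_{μν}(x)` is the curl. [folklore] -/
theorem signed_sum_eq_lcurl (e : D → Λ) (X : Λ → D → M) (x : Λ) (μ ν : D) :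
    X x μ + X (x + e μ) ν - X (x + e ν) μ - X x ν = lcurl e X x μ ν := by
  simp only [lcurl]; abel

/-- the curl of a CONSTANT bond field vanishes. [folklore] -/
@[simp] theorem lcurl_const (e : D → Λ) (c : D → M) (x : Λ) (μ ν : D) : lcurl e (fun _ : Λ => c) x μ ν = 0 := by
  simp only [lcurl]; abel

/-- the curl is additive in the field. [folklore] -/
theorem lcurl_add (e : D → Λ) (X X' : Λ → D → M) (x : Λ) (μ ν : D) :
    lcurl e (X + X') x μ ν = lcurl e X x μ ν + lcurl e X' x μ ν := by
  simp only [lcurl, Pi.add_apply]; abel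

/-- the curl is subtractive in the field. [folklore] -/
theorem lcurl_sub (e : D → Λ) (X X' : Λ → D → M) (x : Λ) (μ ν : D) :
    lcurl e (X - X') x μ ν = lcurl e X x μ ν - lcurl e X' x μ ν := by
  simp only [lcurl, Pi.sub_apply]; abel

/-- the curl SUMS TO ZERO over a finite lattice (each difference telescopes along its translation). [folklore] -/
theorem sum_lcurl [Fintype Λ] (e : D → Λ) (X : Λ → D → M) (μ ν : D) : ∑ x, lcurl e X x μ ν = 0 := by
  have h1 : ∑ x, X (x + e μ) ν = ∑ x, X x ν := Equiv.sum_comp (Equiv.addRight (e μ)) (fun x => X x ν)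
  have h2 : ∑ x, X (x + e ν) μ = ∑ x, X x μ := Equiv.sum_comp (Equiv.addRight (e ν)) (fun x => X x μ)
  simp only [lcurl, Finset.sum_sub_distrib, h1, h2, sub_self]

/-- `SpinTable.curl` is the matrix-valued instance of `lcurl`. [folklore] -/
theorem lcurl_eq_curl {C : Type*} (e : D → Λ) (B : Λ → D → Matrix C C ℝ) : lcurl e B = SpinTable.curl e B := rfl

/-- THE ONE-BOND FIELD: the bond `(z, γ)` carries the letter `Y`, every other bond `0` (for `Matrix C C ℝ`-valued letters it is
`SpinTable.bondField`, `bondLetter_eq_bondField`). [folklore] -/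
def bondLetter [DecidableEq Λ] [DecidableEq D] (z : Λ) (γ : D) (Y : M) : Λ → D → M :=
  fun x δ => if x = z ∧ δ = γ then Y else 0

omit [AddCommGroup Λ] in
/-- `SpinTable.bondField` is the matrix-valued instance of `bondLetter`. [folklore] -/
theorem bondLetter_eq_bondField [DecidableEq Λ] [DecidableEq D] {C : Type*} (z : Λ) (γ : D) (A : Matrix C C ℝ) :
    bondLetter z γ A = SpinTable.bondField z γ A := rfl

end Curl

section Forms

variable {𝕜 : Type*} [Semiring 𝕜] {𝔸 : Type*} [Ring 𝔸] [Module 𝕜 𝔸] {V : Type*} [AddCommMonoid V] [Module 𝕜 V]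
variable {Λ : Type*} [Fintype Λ] [AddCommGroup Λ] {D : Type*} [Fintype D]

/-- THE TRANSPORT (TWIST) SUM of the plaquette `p_{μν}(x)`: the three later fluctuation letters commuted with the background
accumulated before them along the contour, `[B₁,W₂] − [B₁+B₂−B₃, W₃] − [B₁+B₂−B₃−B₄, W₄]` (`WilsonVertex.twist_plaq`; in lattice
indexing `B₁ = B_μ(x)`, `B₂ = B_ν(x+e_μ)`, `B₃ = B_μ(x+e_ν)`, `B₄ = B_ν(x)`, `W` likewise).  Ring level. [folklore] -/
def twistW (e : D → Λ) (W B : Λ → D → 𝔸) (x : Λ) (μ ν : D) : 𝔸 :=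
  br (B x μ) (W (x + e μ) ν) - br (B x μ + B (x + e μ) ν - B (x + e ν) μ) (W (x + e ν) μ)
    - br (B x μ + B (x + e μ) ν - B (x + e ν) μ - B x ν) (W x ν)

omit [Fintype Λ] [Fintype D] in
/-- REGROUPING THE ACCUMULATED BACKGROUNDS of `twistW` (v1.1): the second accumulated sum is `F_{μν}(x) + B_ν(x)` and the
third IS `F_{μν}(x)` (`F = lcurl e B`), so `twistW = [B_μ(x), W_ν(x+e_μ)] − [B_ν(x), W_μ(x+e_ν)] − [F_{μν}(x), W_μ(x+e_ν) + W_ν(x)]`: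
a MINIMAL part (single undifferentiated background letters) plus an `F`-part (header, TWO GRADINGS). [folklore] -/
theorem twistW_regroup (e : D → Λ) (W B : Λ → D → 𝔸) (x : Λ) (μ ν : D) :
    twistW e W B x μ ν =
      br (B x μ) (W (x + e μ) ν) - br (B x ν) (W (x + e ν) μ)
        - br (lcurl e B x μ ν) (W (x + e ν) μ + W x ν) := by
  simp only [twistW, lcurl, br]
  noncomm_ring

/-- THE LOCAL SPIN FORM `Σ_x Σ_{(μ,ν)} τ(F_{μν}(x) · [W_μ(x), W_ν(x)])`, `F = lcurl e B`: both fluctuation letters read AT THE BASE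
SITE of the plaquette — the part of the Wilson `(2,1)`-jet that the site-local MODEL spin operator `SpinTable.spinOp` sees
(`spinLocal_field`).  Ring level; `τ` any linear functional. [folklore] -/
def spinLocal (τ : 𝔸 →ₗ[𝕜] V) (e : D → Λ) (W B : Λ → D → 𝔸) : V :=
  ∑ x, ∑ μ, ∑ ν, τ (lcurl e B x μ ν * br (W x μ) (W x ν))

/-- THE DIFFERENCE SPIN FORM `Σ_x Σ_{(μ,ν)} τ(F_{μν}(x) · pairDiff(W_μ(x), W_ν(x), δ_νW_μ(x), δ_μW_ν(x)))` — the curl on the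
background leg AND one lattice difference on a fluctuation leg (one more table degree than `spinLocal`). [folklore] -/
def spinDiff (τ : 𝔸 →ₗ[𝕜] V) (e : D → Λ) (W B : Λ → D → 𝔸) : V :=
  ∑ x, ∑ μ, ∑ ν, τ (lcurl e B x μ ν * pairDiff (W x μ) (W x ν) (W (x + e ν) μ - W x μ) (W (x + e μ) ν - W x ν))

/-- THE TRANSPORT FORM `Σ_x Σ_{(μ,ν)} τ((lcurl W)_{μν}(x) · twistW)`: the curl of the FLUCTUATION against the background
commutators of the later fluctuation letters — the cross term of `½τ((Z_W + twist)²)`, i.e. the `B`-linear germ of half the square of the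
TRANSPORTED curl `Σ_i ±(x_i + [β_i, x_i])` (the exponential-chart skeleton of the transported fields `A′(b) = R(U₀(·))A(b)` of B9
(3.2)/(3.4), whose square is the covariant `D*D` of (3.10)).  Grading (header, TWO GRADINGS): ≥ 1 fluctuation difference (it vanishes
per plaquette at constant `W`); regrouped, `twistW = [B_μ(x), W_ν(x+e_μ)] − [B_ν(x), W_μ(x+e_ν)] − [F_{μν}(x), W_μ(x+e_ν) + W_ν(x)]`
= a minimal part (single background letter; hopping/current shape) + an `F`-part (the shape of `spinDiff`); no base-point-local
commutator `[W_μ(x), W_ν(x)]` in either.  Not typed as a stencil here. [folklore] -/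
def transport (τ : 𝔸 →ₗ[𝕜] V) (e : D → Λ) (W B : Λ → D → 𝔸) : V :=
  ∑ x, ∑ μ, ∑ ν, τ (lcurl e W x μ ν * twistW e W B x μ ν)

/-- DEGENERACY NOTE: summed over the (finite, periodic) lattice a CONSTANT fluctuation configuration sees NO local spin form
(`Σ_x F_{μν}(x) = 0`, `sum_lcurl`) — unlike the single plaquette of `WilsonVertex.trace_P21_plaq_add_rev_const`; the coefficient of the
spin vertex is therefore read off the identity `spinLocal_field_bondLetter` for ALL coordinates `v` (§3), never at constant `W`. [folklore] -/
theorem spinLocal_const (τ : 𝔸 →ₗ[𝕜] V) (e : D → Λ) (c : D → 𝔸) (B : Λ → D → 𝔸) : spinLocal τ e (fun _ => c) B = 0 := by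
  have h : ∀ μ ν : D, ∑ x, τ (lcurl e B x μ ν * br (c μ) (c ν)) = 0 := fun μ ν => by
    rw [← map_sum, ← Finset.sum_mul, sum_lcurl, zero_mul, map_zero]
  calc spinLocal τ e (fun _ => c) B = ∑ μ, ∑ x, ∑ ν, τ (lcurl e B x μ ν * br (c μ) (c ν)) := Finset.sum_comm
    _ = ∑ μ, ∑ ν, ∑ x, τ (lcurl e B x μ ν * br (c μ) (c ν)) := Finset.sum_congr rfl fun μ _ => Finset.sum_comm
    _ = 0 := by simp only [h, Finset.sum_const_zero]

end Forms

section Words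

variable (𝕜 : Type*) [RCLike 𝕜] {𝔸 : Type*} [NormedRing 𝔸] [NormedAlgebra 𝕜 𝔸]
variable {V : Type*} [AddCommGroup V] [Module 𝕜 V]
variable {Λ : Type*} [Fintype Λ] [AddCommGroup Λ] {D : Type*} [Fintype D]

/-- THE PLAQUETTE WORD OF A LATTICE CONFIGURATION at the oriented plaquette `p_{μν}(x)`: `WilsonVertex.plaq` fed with the
fluctuation letters `W_μ(x), W_ν(x+e_μ), W_μ(x+e_ν), W_ν(x)` and the background letters likewise
(`U_b = e^{W_b}e^{B_b}`). [folklore] -/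
def plaqWord (e : D → Λ) (W B : Λ → D → 𝔸) (x : Λ) (μ ν : D) : List (Bool × 𝔸) :=
  plaq (W x μ) (W (x + e μ) ν) (W (x + e ν) μ) (W x ν) (B x μ) (B (x + e μ) ν) (B (x + e ν) μ) (B x ν)

omit [Fintype Λ] [Fintype D] [NormedAlgebra 𝕜 𝔸] in
/-- swapping the directions reverses the orientation: the word of `p_{νμ}(x)` is the INVERSE word of `p_{μν}(x)`
(`WilsonVertex.inv_plaq`; B9 (3.5) `U(x,x′) = U(x′,x)⁻¹`). [folklore] -/
theorem inv_plaqWord (e : D → Λ) (W B : Λ → D → 𝔸) (x : Λ) (μ ν : D) :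
    inv (plaqWord e W B x μ ν) = plaqWord e W B x ν μ := by
  rw [plaqWord, inv_plaq]; rfl

omit [Fintype Λ] [Fintype D] [NormedAlgebra 𝕜 𝔸] in
/-- the transport sum of the plaquette word is `twistW` (`WilsonVertex.twist_plaq` in lattice indexing). [folklore] -/
theorem twistAux_plaqWord (e : D → Λ) (W B : Λ → D → 𝔸) (x : Λ) (μ ν : D) :
    twistAux 0 (plaqWord e W B x μ ν) = twistW e W B x μ ν := by
  rw [plaqWord, twist_plaq, twistW, br, br, br]

omit [Fintype Λ] [Fintype D] [NormedAlgebra 𝕜 𝔸] in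
/-- the fluctuation letters of the plaquette word sum to the curl of `W`. [folklore] -/
theorem sum_wpart_plaqWord (e : D → Λ) (W B : Λ → D → 𝔸) (x : Λ) (μ ν : D) :
    (wpart (plaqWord e W B x μ ν)).sum = lcurl e W x μ ν := by
  rw [plaqWord, wpart_plaq, sum_four_signed, signed_sum_eq_lcurl]

omit [Fintype Λ] [Fintype D] [NormedAlgebra 𝕜 𝔸] in
/-- the background letters of the plaquette word sum to the curl of `B` (the plaquette field `F_{μν}(x)`). [folklore] -/
theorem sum_bpart_plaqWord (e : D → Λ) (W B : Λ → D → 𝔸) (x : Λ) (μ ν : D) :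
    (bpart (plaqWord e W B x μ ν)).sum = lcurl e B x μ ν := by
  rw [plaqWord, bpart_plaq, sum_four_signed, signed_sum_eq_lcurl]

omit [Fintype Λ] [Fintype D] [NormedAlgebra 𝕜 𝔸] in
/-- the ordered commutator sum of the fluctuation letters is `plaqPairs` at the lattice letters
(`WilsonVertex.commSum_wpart_plaq`). [folklore] -/
theorem commSum_wpart_plaqWord (e : D → Λ) (W B : Λ → D → 𝔸) (x : Λ) (μ ν : D) :
    commSum (wpart (plaqWord e W B x μ ν)) = plaqPairs (W x μ) (W x ν) (W (x + e ν) μ) (W (x + e μ) ν) := by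
  rw [plaqWord, wpart_plaq, commSum_wpart_plaq]

/-- **THE SUMMED `(2,1)`-JET**: the bidegree-`(W², B¹)` Taylor component of `Σ_x Σ_{(μ,ν)} τ U(∂p_{μν}(x))` over ALL sites and
ALL ORDERED direction pairs.  The diagonal words `μ = ν` are trivial and contribute nothing (`trace_P21_plaqWord_self`); each
unoriented plaquette enters with both orientations, i.e. as `τU(∂p) + τU(−∂p) = 2·Re τU(∂p)` (Bałaban's complexified real part,
B9 p. 391), so `−½·jet21` is the `(2,1)`-jet of the plaquette sum `Σ_p (1 − Re τ U(∂p))` over unoriented plaquettes. [folklore] -/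
def jet21 (τ : 𝔸 →ₗ[𝕜] V) (e : D → Λ) (W B : Λ → D → 𝔸) : V :=
  ∑ x, ∑ μ, ∑ ν, τ (P21 𝕜 (plaqWord e W B x μ ν))

/-- **THE SUMMED `(2,0)`-JET** (pure fluctuation, second order): `Σ_x Σ_{(μ,ν)} τ(quad(W-letters of p_{μν}(x)))`
(`TransportVertices.quad`; by `WilsonVertex.quad_map_scale` it is the `σ²`-coefficient of the second-order term). [folklore] -/
def jet20 (τ : 𝔸 →ₗ[𝕜] V) (e : D → Λ) (W B : Λ → D → 𝔸) : V :=
  ∑ x, ∑ μ, ∑ ν, τ (quad 𝕜 (wpart (plaqWord e W B x μ ν)))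

omit [Fintype Λ] [Fintype D] in
/-- per oriented plaquette PLUS its reverse: `τP21(p_{μν}(x)) + τP21(p_{νμ}(x)) = τ(F_{μν}(x)·plaqPairs) + 2τ((lcurl W)·twistW)`
(`WilsonVertex.trace_P21_add_trace_P21_inv` in lattice indexing). [folklore] -/
theorem trace_P21_plaqWord_add_swap (τ : 𝔸 →ₗ[𝕜] V) (hτ : ∀ a b : 𝔸, τ (a * b) = τ (b * a)) (e : D → Λ)
    (W B : Λ → D → 𝔸) (x : Λ) (μ ν : D) :
    τ (P21 𝕜 (plaqWord e W B x μ ν)) + τ (P21 𝕜 (plaqWord e W B x ν μ)) =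
      τ (lcurl e B x μ ν * plaqPairs (W x μ) (W x ν) (W (x + e ν) μ) (W (x + e μ) ν))
        + (2 : 𝕜) • τ (lcurl e W x μ ν * twistW e W B x μ ν) := by
  rw [← inv_plaqWord e W B x μ ν, trace_P21_add_trace_P21_inv 𝕜 τ hτ, sum_bpart_plaqWord, sum_wpart_plaqWord,
    commSum_wpart_plaqWord, twistAux_plaqWord]

omit [Fintype Λ] [Fintype D] in
/-- the diagonal words carry no `(2,1)`-jet: `τP21(p_{μμ}(x)) = 0` (the word `U_μ(x)U_μ(x+e_μ)U_μ(x+e_μ)⁻¹U_μ(x)⁻¹` is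
trivial). [folklore] -/
theorem trace_P21_plaqWord_self (τ : 𝔸 →ₗ[𝕜] V) (hτ : ∀ a b : 𝔸, τ (a * b) = τ (b * a)) (e : D → Λ)
    (W B : Λ → D → 𝔸) (x : Λ) (μ : D) : τ (P21 𝕜 (plaqWord e W B x μ μ)) = 0 := by
  have h := trace_P21_plaqWord_add_swap 𝕜 τ hτ e W B x μ μ
  rw [lcurl_self, lcurl_self, zero_mul, zero_mul, map_zero, smul_zero, add_zero, ← two_smul 𝕜] at h
  have h2 : τ (P21 𝕜 (plaqWord e W B x μ μ)) = (2 : 𝕜)⁻¹ • ((2 : 𝕜) • τ (P21 𝕜 (plaqWord e W B x μ μ))) := by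
    rw [smul_smul, inv_mul_cancel₀ (two_ne_zero' 𝕜), one_smul]
  rw [h2, h, smul_zero]

/-- so the summed jet is a sum over the OFF-DIAGONAL ordered pairs only (genuine plaquettes). [folklore] -/
theorem jet21_eq_offDiag [DecidableEq D] (τ : 𝔸 →ₗ[𝕜] V) (hτ : ∀ a b : 𝔸, τ (a * b) = τ (b * a)) (e : D → Λ)
    (W B : Λ → D → 𝔸) :
    jet21 𝕜 τ e W B = ∑ x, ∑ μ, ∑ ν ∈ Finset.univ.erase μ, τ (P21 𝕜 (plaqWord e W B x μ ν)) := by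
  refine Finset.sum_congr rfl fun x _ => Finset.sum_congr rfl fun μ _ => ?_
  rw [Finset.sum_erase (f := fun ν => τ (P21 𝕜 (plaqWord e W B x μ ν))) Finset.univ
    (trace_P21_plaqWord_self 𝕜 τ hτ e W B x μ)]

/-- **NORMAL FORM OF THE SUMMED `(2,1)`-JET**: `jet21 = Σ_x Σ_{(μ,ν)} [½τ(F_{μν}(x)·plaqPairs) + τ((lcurl W)·twistW)]` — SPIN +
TRANSPORT, no symmetric cubic (symmetrising each ordered pair with its reverse IS Bałaban's real part). [folklore] -/
theorem jet21_eq (τ : 𝔸 →ₗ[𝕜] V) (hτ : ∀ a b : 𝔸, τ (a * b) = τ (b * a)) (e : D → Λ) (W B : Λ → D → 𝔸) :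
    jet21 𝕜 τ e W B = ∑ x, ∑ μ, ∑ ν,
      ((2 : 𝕜)⁻¹ • τ (lcurl e B x μ ν * plaqPairs (W x μ) (W x ν) (W (x + e ν) μ) (W (x + e μ) ν))
        + τ (lcurl e W x μ ν * twistW e W B x μ ν)) := by
  have hx : ∀ x : Λ, (2 : 𝕜) • ∑ μ, ∑ ν, τ (P21 𝕜 (plaqWord e W B x μ ν)) = ∑ μ, ∑ ν,
      (τ (lcurl e B x μ ν * plaqPairs (W x μ) (W x ν) (W (x + e ν) μ) (W (x + e μ) ν))
        + (2 : 𝕜) • τ (lcurl e W x μ ν * twistW e W B x μ ν)) := by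
    intro x
    have hsym : ∑ μ, ∑ ν, τ (P21 𝕜 (plaqWord e W B x μ ν)) = ∑ μ, ∑ ν, τ (P21 𝕜 (plaqWord e W B x ν μ)) :=
      Finset.sum_comm
    rw [two_smul]
    nth_rewrite 2 [hsym]
    rw [← Finset.sum_add_distrib]
    refine Finset.sum_congr rfl fun μ _ => ?_
    rw [← Finset.sum_add_distrib]
    refine Finset.sum_congr rfl fun ν _ => ?_
    rw [trace_P21_plaqWord_add_swap 𝕜 τ hτ e W B x μ ν]
  have h3 : jet21 𝕜 τ e W B = (2 : 𝕜)⁻¹ • ((2 : 𝕜) • jet21 𝕜 τ e W B) := by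
    rw [smul_smul, inv_mul_cancel₀ (two_ne_zero' 𝕜), one_smul]
  rw [h3, jet21, Finset.smul_sum, Finset.smul_sum]
  refine Finset.sum_congr rfl fun x _ => ?_
  rw [hx x, Finset.smul_sum]
  refine Finset.sum_congr rfl fun μ _ => ?_
  rw [Finset.smul_sum]
  refine Finset.sum_congr rfl fun ν _ => ?_
  rw [smul_add, smul_smul, inv_mul_cancel₀ (two_ne_zero' 𝕜), one_smul]

/-- **THE THREE-FORM SPLIT**: `jet21 = spinLocal + ½·spinDiff + transport`. [folklore] -/
theorem jet21_split (τ : 𝔸 →ₗ[𝕜] V) (hτ : ∀ a b : 𝔸, τ (a * b) = τ (b * a)) (e : D → Λ) (W B : Λ → D → 𝔸) :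
    jet21 𝕜 τ e W B = spinLocal τ e W B + (2 : 𝕜)⁻¹ • spinDiff τ e W B + transport τ e W B := by
  rw [jet21_eq 𝕜 τ hτ, spinLocal, spinDiff, transport, Finset.smul_sum, ← Finset.sum_add_distrib,
    ← Finset.sum_add_distrib]
  refine Finset.sum_congr rfl fun x _ => ?_
  rw [Finset.smul_sum, ← Finset.sum_add_distrib, ← Finset.sum_add_distrib]
  refine Finset.sum_congr rfl fun μ _ => ?_
  rw [Finset.smul_sum, ← Finset.sum_add_distrib, ← Finset.sum_add_distrib]
  refine Finset.sum_congr rfl fun ν _ => ?_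
  have h2 : τ (lcurl e B x μ ν * (2 * br (W x μ) (W x ν))) = (2 : 𝕜) • τ (lcurl e B x μ ν * br (W x μ) (W x ν)) := by
    rw [two_mul, mul_add, map_add, two_smul]
  rw [plaqPairs_eq_local_add_pairDiff, mul_add, map_add, h2]
  module

/-- **NORMAL FORM OF THE SUMMED `(2,0)`-JET**: `jet20 = ½ Σ_x Σ_{(μ,ν)} τ((lcurl W)_{μν}(x)²)` — the square of the fluctuation's
curl (the `U₀ = 1` kinetic term of B9 (3.6)/(3.7)); `−½·jet20` is the `(2,0)`-jet of `Σ_p (1 − Re τ U(∂p))`. [folklore] -/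
theorem jet20_eq (τ : 𝔸 →ₗ[𝕜] V) (hτ : ∀ a b : 𝔸, τ (a * b) = τ (b * a)) (e : D → Λ) (W B : Λ → D → 𝔸) :
    jet20 𝕜 τ e W B = ∑ x, ∑ μ, ∑ ν, (2 : 𝕜)⁻¹ • τ (lcurl e W x μ ν * lcurl e W x μ ν) := by
  refine Finset.sum_congr rfl fun x _ => Finset.sum_congr rfl fun μ _ => Finset.sum_congr rfl fun ν _ => ?_
  have h := two_smul_trace_quad 𝕜 τ hτ (wpart (plaqWord e W B x μ ν))
  rw [sum_wpart_plaqWord] at h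
  rw [← h, smul_smul, inv_mul_cancel₀ (two_ne_zero' 𝕜), one_smul]

end Words

/-! ## §3 Colour coordinates: the local spin form IS the quadratic form of `SpinTable.spinOp`, and at a one-bond background that of
`SpinTable.spinVertex` — the explicit-term spin coupling, DERIVED -/

section Coordinates

variable {𝔸 : Type*} [Ring 𝔸] [Algebra ℝ 𝔸]
variable {Λ : Type*} [Fintype Λ] [DecidableEq Λ] [AddCommGroup Λ] {C : Type*} [Fintype C] [DecidableEq C]
  {D : Type*} [Fintype D] [DecidableEq D]

/-- COORDINATES → FIELD: `W_k(x) = Σ_a v(x,(a,k)) • t_a` for a letter family `t : C → 𝔸` (the fluctuation vector `v` indexed by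
`Λ × (C × D)` = site × (colour × direction), `SpinTable`'s carrier). [folklore] -/
def field (t : C → 𝔸) (v : Λ × (C × D) → ℝ) : Λ → D → 𝔸 := fun x k => ∑ a, v (x, (a, k)) • t a

/-- the same coordinates as a real bond field with values in `C → ℝ`. [folklore] -/
def coords (v : Λ × (C × D) → ℝ) : Λ → D → C → ℝ := fun x k a => v (x, (a, k))

/-- THE COLOUR MATRIX OF A LETTER `F` in the family `t` for the trace `τ`: `adM τ t F a b := τ(F · [t_a, t_b])`.  For a family
orthonormal and complete for the form `−τ(XY)` this is the matrix of `ad_F = [F, ·]`: `[F, t_b] = Σ_a (adM F)_{ab} t_a`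
(`adM_pairing`: `−τ(t_a·[F,t_b]) = adM F a b` is the coordinate pairing); for Bałaban's Hermitian generators it is
`ColourTrace.adMat` on the nose (`adM_gen`, §4).  A definition asserting nothing. [folklore] -/
def adM (τ : 𝔸 →ₗ[ℝ] ℝ) (t : C → 𝔸) (F : 𝔸) : Matrix C C ℝ := Matrix.of fun a b => τ (F * br (t a) (t b))

/-- THE GRAM MATRIX of the family for the form `−τ(XY)`: `gram τ t a b := −τ(t_a t_b)`. [folklore] -/
def gram (τ : 𝔸 →ₗ[ℝ] ℝ) (t : C → 𝔸) : Matrix C C ℝ := Matrix.of fun a b => -τ (t a * t b)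

omit [Fintype C] [DecidableEq C] in
/-- entries of `adM`. [folklore] -/
@[simp] theorem adM_apply (τ : 𝔸 →ₗ[ℝ] ℝ) (t : C → 𝔸) (F : 𝔸) (a b : C) : adM τ t F a b = τ (F * br (t a) (t b)) := rfl

omit [Fintype C] [DecidableEq C] in
/-- entries of `gram`. [folklore] -/
@[simp] theorem gram_apply (τ : 𝔸 →ₗ[ℝ] ℝ) (t : C → 𝔸) (a b : C) : gram τ t a b = -τ (t a * t b) := rfl

omit [Fintype C] [DecidableEq C] in
/-- THE COORDINATE PAIRING: for tracial `τ`, `−τ(t_a · (F t_b − t_b F)) = adM τ t F a b` — the `(−τ)`-pairing of `t_a` with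
`ad_F(t_b)`. [folklore] -/
theorem adM_pairing (τ : 𝔸 →ₗ[ℝ] ℝ) (hτ : ∀ a b : 𝔸, τ (a * b) = τ (b * a)) (t : C → 𝔸) (F : 𝔸) (a b : C) :
    -τ (t a * (F * t b - t b * F)) = adM τ t F a b := by
  rw [adM_apply, br, mul_sub, mul_sub, map_sub, map_sub, ← mul_assoc, ← mul_assoc, hτ (t a * F) (t b), ← mul_assoc,
    hτ (t b * t a) F, hτ (t a * t b) F, ← mul_assoc]
  abel

omit [Fintype C] [DecidableEq C] in
/-- `adM` is subtractive in the letter. [folklore] -/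
theorem adM_sub (τ : 𝔸 →ₗ[ℝ] ℝ) (t : C → 𝔸) (F F' : 𝔸) : adM τ t (F - F') = adM τ t F - adM τ t F' := by
  ext a b; simp only [adM_apply, Matrix.sub_apply, sub_mul, map_sub]

omit [Fintype C] [DecidableEq C] in
/-- `adM` of the zero letter. [folklore] -/
@[simp] theorem adM_zero (τ : 𝔸 →ₗ[ℝ] ℝ) (t : C → 𝔸) : adM τ t 0 = 0 := by
  ext a b; simp only [adM_apply, zero_mul, map_zero, Matrix.zero_apply]

omit [Fintype C] [DecidableEq C] in
/-- `adM` is antisymmetric (no hypothesis on `t` or `τ`). [folklore] -/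
theorem adM_antisymm (τ : 𝔸 →ₗ[ℝ] ℝ) (t : C → 𝔸) (F : 𝔸) (a b : C) :
    adM τ t F b a = -adM τ t F a b := by
  simp only [adM_apply, br, mul_sub, map_sub]
  abel

omit [DecidableEq C] in
/-- the commutator of two coordinate combinations: `[Σ c_a t_a, Σ c′_b t_b] = Σ_a Σ_b (c_a c′_b)·[t_a, t_b]`. [folklore] -/
theorem br_sum_smul (t : C → 𝔸) (c c' : C → ℝ) :
    br (∑ a, c a • t a) (∑ b, c' b • t b) = ∑ a, ∑ b, (c a * c' b) • br (t a) (t b) := by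
  simp only [br, smul_sub, Finset.sum_sub_distrib]
  congr 1
  · rw [Finset.sum_mul_sum]
    simp only [smul_mul_assoc, mul_smul_comm, smul_smul, mul_comm (c' _) (c _)]
  · rw [Finset.sum_mul_sum, Finset.sum_comm]
    simp only [smul_mul_assoc, mul_smul_comm, smul_smul]

omit [DecidableEq C] in
/-- the trace of a letter against the commutator of two coordinate combinations, in coordinates:
`τ(F·[W,W′]) = Σ_a Σ_b c_a c′_b (adM F)_{ab}`. [folklore] -/
theorem trace_mul_br_sum (τ : 𝔸 →ₗ[ℝ] ℝ) (t : C → 𝔸) (F : 𝔸) (c c' : C → ℝ) :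
    τ (F * br (∑ a, c a • t a) (∑ b, c' b • t b)) = ∑ a, ∑ b, c a * c' b * adM τ t F a b := by
  rw [br_sum_smul, Finset.mul_sum, map_sum]
  refine Finset.sum_congr rfl fun a _ => ?_
  rw [Finset.mul_sum, map_sum]
  refine Finset.sum_congr rfl fun b _ => ?_
  rw [mul_smul_comm, map_smul, smul_eq_mul, adM_apply]

omit [DecidableEq C] in
/-- the trace of a product of two coordinate combinations: `τ(WW′) = −Σ_a Σ_b c_a c′_b G_{ab}`. [folklore] -/
theorem trace_sum_mul_sum (τ : 𝔸 →ₗ[ℝ] ℝ) (t : C → 𝔸) (c c' : C → ℝ) :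
    τ ((∑ a, c a • t a) * (∑ b, c' b • t b)) = -∑ a, ∑ b, c a * gram τ t a b * c' b := by
  rw [Finset.sum_mul_sum, map_sum, ← Finset.sum_neg_distrib]
  refine Finset.sum_congr rfl fun a _ => ?_
  rw [map_sum, ← Finset.sum_neg_distrib]
  refine Finset.sum_congr rfl fun b _ => ?_
  rw [smul_mul_assoc, mul_smul_comm, smul_smul, map_smul, smul_eq_mul, gram_apply]
  ring

omit [AddCommGroup Λ] [DecidableEq C] [DecidableEq D] in
/-- **THE QUADRATIC FORM OF THE SPIN OPERATOR**: `v ⬝ᵥ (spinOp Φ) v = Σ_x Σ_{(a,k)} Σ_{(b,k′)} v(x,a,k)·Φ_x(k,k′)_{ab}·v(x,b,k′)`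
(block-diagonal in the sites, `SpinTable.spinOp_apply`). [folklore] -/
theorem dotProduct_spinOp_mulVec (Φ : Λ → D → D → Matrix C C ℝ) (v w : Λ × (C × D) → ℝ) :
    v ⬝ᵥ (spinOp Φ *ᵥ w) = ∑ x, ∑ a, ∑ k, ∑ b, ∑ k', v (x, (a, k)) * Φ x k k' a b * w (x, (b, k')) := by
  simp only [dotProduct, Matrix.mulVec, Fintype.sum_prod_type]
  refine Finset.sum_congr rfl fun x _ => Finset.sum_congr rfl fun a _ => Finset.sum_congr rfl fun k _ => ?_
  have key : (∑ y, ∑ b, ∑ k', spinOp Φ (x, (a, k)) (y, (b, k')) * w (y, (b, k'))) =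
      ∑ b, ∑ k', Φ x k k' a b * w (x, (b, k')) := by
    rw [Finset.sum_eq_single_of_mem x (Finset.mem_univ x)]
    · simp only [spinOp_apply, ↓reduceIte]
    · intro y _ hyx
      simp only [spinOp_apply, if_neg (fun h : x = y => hyx h.symm), zero_mul, Finset.sum_const_zero]
  rw [key, Finset.mul_sum]
  refine Finset.sum_congr rfl fun b _ => ?_
  rw [Finset.mul_sum]
  refine Finset.sum_congr rfl fun k' _ => ?_
  ring

omit [Fintype Λ] [DecidableEq Λ] [AddCommGroup Λ] [DecidableEq C] [DecidableEq D] in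
/-- sum bookkeeping: `Σ_μ Σ_ν Σ_a Σ_b = Σ_a Σ_μ Σ_b Σ_ν`. [folklore] -/
theorem sum_comm₄ (f : D → D → C → C → ℝ) :
    ∑ μ, ∑ ν, ∑ a, ∑ b, f μ ν a b = ∑ a, ∑ μ, ∑ b, ∑ ν, f μ ν a b := by
  calc ∑ μ, ∑ ν, ∑ a, ∑ b, f μ ν a b = ∑ μ, ∑ a, ∑ ν, ∑ b, f μ ν a b :=
        Finset.sum_congr rfl fun μ _ => Finset.sum_comm
    _ = ∑ a, ∑ μ, ∑ ν, ∑ b, f μ ν a b := Finset.sum_comm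
    _ = ∑ a, ∑ μ, ∑ b, ∑ ν, f μ ν a b :=
        Finset.sum_congr rfl fun a _ => Finset.sum_congr rfl fun μ _ => Finset.sum_comm

omit [DecidableEq C] [DecidableEq D] in
/-- **THE LOCAL SPIN FORM IN COORDINATES IS THE QUADRATIC FORM OF THE MODEL SPIN OPERATOR** of the plaquette field
`Φ_x(k,k′) = adM(F_{kk′}(x))`: `spinLocal τ e (field t v) B = v ⬝ᵥ spinOp(adM ∘ lcurl e B) v` — for EVERY background `B`, every
letter family `t`, every ℝ-linear `τ` (no traciality, no orthonormality needed here). [folklore] -/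
theorem spinLocal_field (τ : 𝔸 →ₗ[ℝ] ℝ) (t : C → 𝔸) (e : D → Λ) (v : Λ × (C × D) → ℝ) (B : Λ → D → 𝔸) :
    spinLocal τ e (field t v) B = v ⬝ᵥ (spinOp (fun x k k' => adM τ t (lcurl e B x k k')) *ᵥ v) := by
  rw [dotProduct_spinOp_mulVec, spinLocal]
  refine Finset.sum_congr rfl fun x _ => ?_
  simp only [field, trace_mul_br_sum]
  -- LHS: Σ μ, Σ ν, Σ a, Σ b, v(x,a,μ) v(x,b,ν) adM(F μ ν) a b ; RHS: Σ a, Σ k, Σ b, Σ k', v Φ v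
  refine (sum_comm₄ _).trans ?_
  refine Finset.sum_congr rfl fun a _ => Finset.sum_congr rfl fun μ _ => Finset.sum_congr rfl fun b _ =>
    Finset.sum_congr rfl fun ν _ => ?_
  ring

omit [Fintype Λ] [Fintype C] [DecidableEq C] [Fintype D] in
/-- the plaquette field of the one-bond background, in colour matrices: `adM ∘ lcurl e (bondLetter z γ Y) =
SpinTable.curl e (SpinTable.bondField z γ (adM Y))`. [folklore] -/
theorem adM_lcurl_bondLetter (τ : 𝔸 →ₗ[ℝ] ℝ) (t : C → 𝔸) (e : D → Λ) (z : Λ) (γ : D) (Y : 𝔸) :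
    (fun x k k' => adM τ t (lcurl e (bondLetter z γ Y) x k k')) =
      SpinTable.curl e (SpinTable.bondField z γ (adM τ t Y)) := by
  funext x k k'
  have h : ∀ (y : Λ) (δ : D), adM τ t (bondLetter z γ Y y δ) = SpinTable.bondField z γ (adM τ t Y) y δ := by
    intro y δ
    by_cases hp : y = z ∧ δ = γ
    · simp only [bondLetter, SpinTable.bondField, if_pos hp]
    · simp only [bondLetter, SpinTable.bondField, if_neg hp, adM_zero]
  simp only [lcurl, SpinTable.curl, adM_sub, h]

omit [DecidableEq C] in
/-- **THE EXPLICIT PLAQUETTE SPIN TERM AT A ONE-BOND BACKGROUND IS `SpinTable.spinVertex`, COEFFICIENT ONE.**  For the background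
`U₀ = e^{B}` supported on the single bond `(z,γ)` with letter `Y`, and ANY fluctuation in coordinates `v`:
`spinLocal τ e (field t v) (bondLetter z γ Y) = v ⬝ᵥ spinVertex e z γ (adM Y) v` — the local part of the Wilson `(2,1)`-jet is
the quadratic form of the MODEL spin vertex of `Beta.SpinTable` §2 with the colour matrix `adM Y` of the background letter and
unit coefficient (`SpinTable.spinOp_curl_bondField` does the identification). [folklore] -/
theorem spinLocal_field_bondLetter (τ : 𝔸 →ₗ[ℝ] ℝ) (t : C → 𝔸) (e : D → Λ) (v : Λ × (C × D) → ℝ) (z : Λ) (γ : D) (Y : 𝔸) :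
    spinLocal τ e (field t v) (bondLetter z γ Y) = v ⬝ᵥ (spinVertex e z γ (adM τ t Y) *ᵥ v) := by
  rw [spinLocal_field, adM_lcurl_bondLetter, spinOp_curl_bondField]

omit [Fintype Λ] [DecidableEq Λ] [DecidableEq C] [Fintype D] [DecidableEq D] in
/-- the curl of the coordinate field is the coordinate combination of the curls of the coordinates. [folklore] -/
theorem lcurl_field (t : C → 𝔸) (e : D → Λ) (v : Λ × (C × D) → ℝ) (x : Λ) (μ ν : D) :
    lcurl e (field t v) x μ ν = ∑ a, lcurl e (coords v) x μ ν a • t a := by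
  simp only [lcurl, field, coords, Pi.sub_apply, sub_smul, Finset.sum_sub_distrib]

/-- THE `G`-WEIGHTED CURL FORM of a real bond field `u : Λ → D → C → ℝ`: `Σ_x Σ_{(μ,ν)} (lcurl u)ᵀ G (lcurl u)` (over ORDERED
pairs: twice the sum over plaquettes). [folklore] -/
def curlForm (G : Matrix C C ℝ) (e : D → Λ) (u : Λ → D → C → ℝ) : ℝ :=
  ∑ x, ∑ μ, ∑ ν, ∑ a, ∑ b, lcurl e u x μ ν a * G a b * lcurl e u x μ ν b

omit [DecidableEq Λ] [DecidableEq C] [DecidableEq D] in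
/-- **THE `(2,0)`-JET IN COORDINATES**: `Σ_x Σ_{(μ,ν)} τ((lcurl W)²) = −curlForm (gram τ t) e (coords v)` — so the kinetic
`(2,0)`-jet `−½·jet20 = ¼·curlForm G` of `Σ_p (1 − Re τU)` is `½⟨v, curl†_G curl v⟩` with
`⟨v, curl†_G curl v⟩ = Σ_x Σ_{μ<ν} (curl v)ᵀ G (curl v) = ½·curlForm G`: the Gram matrix `G = gram τ t` is the colour metric of
the kinetic term, `= 1` exactly for a `(−τ)`-orthonormal family (§4) — the normalisation in which the spin coupling is measured.
[folklore] -/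
theorem sum_trace_lcurl_sq_field (τ : 𝔸 →ₗ[ℝ] ℝ) (t : C → 𝔸) (e : D → Λ) (v : Λ × (C × D) → ℝ) :
    (∑ x, ∑ μ, ∑ ν, τ (lcurl e (field t v) x μ ν * lcurl e (field t v) x μ ν)) = -curlForm (gram τ t) e (coords v) := by
  rw [curlForm, ← Finset.sum_neg_distrib]
  refine Finset.sum_congr rfl fun x _ => ?_
  rw [← Finset.sum_neg_distrib]
  refine Finset.sum_congr rfl fun μ _ => ?_
  rw [← Finset.sum_neg_distrib]
  refine Finset.sum_congr rfl fun ν _ => ?_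
  rw [lcurl_field, trace_sum_mul_sum]

end Coordinates

section CoordinatesNormed

variable {𝔸 : Type*} [NormedRing 𝔸] [NormedAlgebra ℝ 𝔸]
variable {Λ : Type*} [Fintype Λ] [DecidableEq Λ] [AddCommGroup Λ] {C : Type*} [Fintype C] [DecidableEq C]
  {D : Type*} [Fintype D] [DecidableEq D]

omit [DecidableEq Λ] [DecidableEq C] [DecidableEq D] in
/-- **THE KINETIC NORMALISATION**: `jet20 ℝ τ e (field t v) B = −½·curlForm (gram τ t) e (coords v)`. [folklore] -/
theorem jet20_field (τ : 𝔸 →ₗ[ℝ] ℝ) (hτ : ∀ a b : 𝔸, τ (a * b) = τ (b * a)) (t : C → 𝔸) (e : D → Λ)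
    (v : Λ × (C × D) → ℝ) (B : Λ → D → 𝔸) :
    jet20 ℝ τ e (field t v) B = -((2 : ℝ)⁻¹ * curlForm (gram τ t) e (coords v)) := by
  rw [jet20_eq ℝ τ hτ, show -((2 : ℝ)⁻¹ * curlForm (gram τ t) e (coords v)) =
      (2 : ℝ)⁻¹ • (-curlForm (gram τ t) e (coords v)) by rw [smul_eq_mul, mul_neg],
    ← sum_trace_lcurl_sq_field, Finset.smul_sum]
  refine Finset.sum_congr rfl fun x _ => ?_
  rw [Finset.smul_sum]
  refine Finset.sum_congr rfl fun μ _ => ?_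
  rw [Finset.smul_sum]

omit [DecidableEq C] in
/-- **THE EXPLICIT-TERM SPIN COUPLING, DERIVED.**  In the Hessian convention `S₂ = ½·vᵀHv` for the plaquette sum
`S = Σ_p (1 − Re τ U(∂p))` (unoriented plaquettes; `(2,1)`-jet `= −½·jet21`, header), at the one-bond background `(z,γ,Y)` and for
EVERY fluctuation in coordinates `v`: `−½·jet21 = ½·vᵀ(s_expl • spinVertex e z γ (adM Y))v − ¼·spinDiff − ½·transport` with
`s_expl = −1` — the LOCAL part is ONE unit of `SpinTable`'s spin vertex (sign `−1` in `SpinTable`'s orientation conventions `spinDir`,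
`inner`, `curl`; the table sees `s²` only, `SpinTable.coeff_sq_iff`), the remainder is the difference spin form (one table degree up)
and the transport form (current type), both explicit. [folklore] -/
theorem actionJet21_field_bondLetter (τ : 𝔸 →ₗ[ℝ] ℝ) (hτ : ∀ a b : 𝔸, τ (a * b) = τ (b * a)) (t : C → 𝔸) (e : D → Λ)
    (v : Λ × (C × D) → ℝ) (z : Λ) (γ : D) (Y : 𝔸) :
    -((2 : ℝ)⁻¹ * jet21 ℝ τ e (field t v) (bondLetter z γ Y)) =
      (2 : ℝ)⁻¹ * (v ⬝ᵥ (((-1 : ℝ) • spinVertex e z γ (adM τ t Y)) *ᵥ v))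
        - (4 : ℝ)⁻¹ * spinDiff τ e (field t v) (bondLetter z γ Y) - (2 : ℝ)⁻¹ * transport τ e (field t v) (bondLetter z γ Y) := by
  rw [jet21_split ℝ τ hτ, spinLocal_field_bondLetter, Matrix.smul_mulVec, dotProduct_smul, smul_eq_mul, smul_eq_mul]
  ring

end CoordinatesNormed

/-! ## §4 Bałaban's letters: `𝔸 = Mat_N(ℂ)` as a real algebra, `τ = Re tr` (normalised), anti-Hermitian generators `iτ_c` —
the colour matrix is `ColourTrace.adMat` and the kinetic metric is `1` -/

section MatrixLetters

open ColourTrace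

variable {N : ℕ} {C : Type*} [Fintype C] [DecidableEq C]

/-- THE REAL PART OF THE NORMALISED TRACE as an `ℝ`-linear functional on `Mat_N(ℂ)` (B9 p. 392 «the trace is normalized,
i.e., tr 1 = 1»; the Wilson action takes `Re tr`). [folklore] -/
def rntr : Matrix (Fin N) (Fin N) ℂ →ₗ[ℝ] ℝ :=
  (N : ℝ)⁻¹ • (Complex.reLm.comp (Matrix.traceLinearMap (Fin N) ℝ ℂ))

/-- unfolding `rntr`. [folklore] -/
theorem rntr_apply (X : Matrix (Fin N) (Fin N) ℂ) : rntr X = (N : ℝ)⁻¹ * (Matrix.trace X).re := rfl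

/-- `rntr` is the real part of `ColourTrace.ntr`. [folklore] -/
theorem rntr_eq_ntr_re (X : Matrix (Fin N) (Fin N) ℂ) : rntr X = (ntr X).re := by
  rw [rntr_apply, ntr, Complex.div_natCast_re]
  ring

/-- `rntr` is tracial. [folklore] -/
theorem rntr_comm (X Y : Matrix (Fin N) (Fin N) ℂ) : rntr (X * Y) = rntr (Y * X) := by
  rw [rntr_apply, rntr_apply, Matrix.trace_mul_comm]

/-- BAŁABAN'S LETTERS: the anti-Hermitian family `t_c = i·τ_c` of a generator family `τ` (`U = exp(iηA)`, `A = Σ_a A^a τ_a`, B9 (3.1)).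
[folklore] -/
def gen (τ : C → Matrix (Fin N) (Fin N) ℂ) : C → Matrix (Fin N) (Fin N) ℂ := fun c => Complex.I • τ c

omit [Fintype C] [DecidableEq C] in
/-- **THE COLOUR MATRIX OF THE BACKGROUND LETTER `iτ_c` IS `ColourTrace.adMat τ (τ_c)`** — the very matrix `Beta.SpinTable` §5
(`three_sectors_gen`) and `Beta.GhostTable` §7 feed to the vertices (no hypothesis on the family: cyclicity of the trace only).
[folklore] -/
theorem adM_gen (τ : C → Matrix (Fin N) (Fin N) ℂ) (c : C) : adM rntr (gen τ) (gen τ c) = adMat τ (τ c) := by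
  ext a b
  rw [adM_apply, adMat_apply, rntr_eq_ntr_re]
  congr 1
  simp only [gen, br, adMatC, Matrix.of_apply, ntr, ibr, Matrix.smul_mul, Matrix.mul_smul, smul_sub, Matrix.mul_sub,
    smul_smul, Complex.I_mul_I, Matrix.trace_smul, Matrix.trace_sub, smul_eq_mul]
  have h1 : (τ a * (τ c * τ b)).trace = (τ c * (τ b * τ a)).trace := by
    rw [← Matrix.mul_assoc, Matrix.trace_mul_comm, ← Matrix.mul_assoc, Matrix.trace_mul_comm]
  have h2 : (τ a * (τ b * τ c)).trace = (τ c * (τ a * τ b)).trace := by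
    rw [← Matrix.mul_assoc, Matrix.trace_mul_comm]
  rw [h1, h2]
  ring

omit [Fintype C] in
/-- **THE KINETIC METRIC IS `1`** for a tr-orthonormal family (`ColourTrace.TrOrthonormal`: `Tr τ_aτ_b = N·δ_ab`):
`gram rntr (iτ) = 1` — `−Re tr(iτ_a·iτ_b) = Re tr(τ_aτ_b) = δ_ab`. [folklore] -/
theorem gram_gen {τ : C → Matrix (Fin N) (Fin N) ℂ} (ho : TrOrthonormal τ) (hN : N ≠ 0) : gram rntr (gen τ) = 1 := by
  ext a b
  rw [gram_apply, rntr_apply, gen, gen, Matrix.smul_mul, Matrix.mul_smul, smul_smul, Complex.I_mul_I, Matrix.trace_smul,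
    ho a b, Matrix.one_apply]
  have hN' : (N : ℝ) ≠ 0 := Nat.cast_ne_zero.mpr hN
  split_ifs <;> simp [hN']

end MatrixLetters

section BalabanLetters

open ColourTrace

-- Mathlib's `L¹–L^∞` operator norm on square matrices (`Matrix.linftyOpNormedRing` / `Matrix.linftyOpNormedAlgebra`) is a `def`, not a
-- global instance; it is enabled LOCALLY for this section only, as Mathlib intends — ANY submultiplicative norm serves: the statement
-- below is norm-free algebra, the norm is only the carrier structure `WilsonVertex.plaq`/`P21` are typed over.
attribute [local instance] Matrix.linftyOpNormedRing Matrix.linftyOpNormedAlgebra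

variable {N : ℕ} {C : Type*} [Fintype C] [DecidableEq C]
variable {Λ : Type*} [Fintype Λ] [DecidableEq Λ] [AddCommGroup Λ] {D : Type*} [Fintype D] [DecidableEq D]

omit [DecidableEq C] in
/-- **BAŁABAN'S LETTERS VERBATIM.**  `𝔸 = Mat_N(ℂ)`, `τ = Re tr` (normalised), fluctuation letters `W_k(x) = Σ_a v(x,(a,k))·iτ_a`,
background `U₀ = exp` of the single letter `iτ_c` on the bond `(z,γ)`, every `v`: the `(W², B¹)` jet of `Σ_p[1 − Re tr U(∂p)]` is
`½·vᵀ((−1)•SpinTable.spinVertex e z γ (ColourTrace.adMat τ (τ_c)))v − ¼·spinDiff − ½·transport` — `SpinTable`'s spin vertex with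
the very colour matrix of `SpinTable.three_sectors_gen`, coefficient `−1` (no hypothesis on the generator family). [folklore] -/
theorem actionJet21_field_bondLetter_gen (τ : C → Matrix (Fin N) (Fin N) ℂ) (e : D → Λ) (v : Λ × (C × D) → ℝ) (z : Λ) (γ : D)
    (c : C) :
    -((2 : ℝ)⁻¹ * jet21 ℝ rntr e (field (gen τ) v) (bondLetter z γ (gen τ c))) =
      (2 : ℝ)⁻¹ * (v ⬝ᵥ (((-1 : ℝ) • spinVertex e z γ (adMat τ (τ c))) *ᵥ v))
        - (4 : ℝ)⁻¹ * spinDiff rntr e (field (gen τ) v) (bondLetter z γ (gen τ c))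
        - (2 : ℝ)⁻¹ * transport rntr e (field (gen τ) v) (bondLetter z γ (gen τ c)) := by
  rw [actionJet21_field_bondLetter rntr rntr_comm (gen τ) e v z γ (gen τ c), adM_gen]

end BalabanLetters

/-! ## §5 Coefficient bookkeeping against `SpinTable.coeff_sq_iff` (the second unit stays LABELLED) -/

section Bookkeeping

/-- THE EXPLICIT-TERM SPIN COUPLING: `−1` (the coefficient of the spin vertex in `actionJet21_field_bondLetter`). [folklore] -/
def sExpl : ℝ := -1

/-- its square is `1`: ONE unit. [folklore] -/
theorem sExpl_sq : sExpl ^ 2 = 1 := by norm_num [sExpl]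

/-- **THE EXPLICIT PLAQUETTE TERM ALONE DOES NOT REPRODUCE THE TABLE**: with `s = sExpl` the model's square coefficient `2N²s²` is
`2N²`, one quarter of the realised `8N²` (`SpinTable.coeff_sq_iff` needs `s² = 4`). [folklore] -/
theorem coeff_sq_sExpl {N : ℝ} (hN : N ≠ 0) : 2 * N ^ 2 * sExpl ^ 2 ≠ 8 * N ^ 2 := by
  rw [Ne, coeff_sq_iff hN, sExpl_sq]
  norm_num

/-- … while TWO units of the same sign DO: `(sExpl + sExpl)² = 4` — the second unit (the curvature term of the Weitzenböck identity
for Bałaban's covariant `D*D` completed longitudinally, B9 p. 395 (3.26) `Δ_a = Δ + DRD* + Q*aQ` / [Balaban1987RG1] p. 260 (1.5)) is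
LOCATED, not derived here (`SpinTable` header (i)). [folklore] -/
theorem coeff_sq_two_units {N : ℝ} (hN : N ≠ 0) : 2 * N ^ 2 * (sExpl + sExpl) ^ 2 = 8 * N ^ 2 := by
  rw [coeff_sq_iff hN]
  norm_num [sExpl]

end Bookkeeping

/-! ## Examples -/

section Examples

variable {𝔸 : Type*} [NormedRing 𝔸] [NormedAlgebra ℝ 𝔸]

/-- the local/difference split at a constant fluctuation: `plaqPairs X Y X Y = 2[X,Y] + 0`. [folklore] -/
example (X Y : 𝔸) : plaqPairs X Y X Y = 2 * br X Y := by
  rw [plaqPairs_eq_local_add_pairDiff, sub_self, sub_self, pairDiff_zero_zero, add_zero]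

/-- the explicit unit against the realised table at `N = 3`: `2·9·1 ≠ 72 = 2·9·4`. [folklore] -/
example : 2 * (3 : ℝ) ^ 2 * sExpl ^ 2 ≠ 8 * (3 : ℝ) ^ 2 ∧ 2 * (3 : ℝ) ^ 2 * (sExpl + sExpl) ^ 2 = 8 * (3 : ℝ) ^ 2 :=
  ⟨coeff_sq_sExpl (by norm_num), coeff_sq_two_units (by norm_num)⟩

/-- the Pauli instance of §4: the colour matrix of the background letter `iσ_c` is `adMat pauli (pauli c)`, and the kinetic metric
of the letters `iσ_a` is `1`. [folklore] -/
example (c : Fin 3) : adM rntr (gen ColourTrace.pauli) (gen ColourTrace.pauli c) = ColourTrace.adMat ColourTrace.pauli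
    (ColourTrace.pauli c) ∧ gram rntr (gen ColourTrace.pauli) = 1 :=
  ⟨adM_gen _ c, gram_gen ColourTrace.pauli_trOrthonormal (by norm_num)⟩

end Examples

end Literature.MathematicalPhysics.QuantumFieldTheory.Balaban1983to89.Beta.PlaquetteVertex
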